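import Literature.MathematicalPhysics.KineticTheory.ReyBelletThomas2002Growth
import Literature.MathematicalPhysics.KineticTheory.ReyBelletThomas2002EnergyIdentity
import Literature.MathematicalPhysics.KineticTheory.LangevinChainScalingLimit
import HarnessLib

/-!
# Rey-Bellet–Thomas 2002, §3.1: the high-energy rescaling of the reservoir-driven chain

Trunk T-KINETIC (Literature/MathematicalPhysics/KineticTheory). Inline step towards Theorem 3.3 /
Theorem 3.10 for the named fact `ReyBelletThomas2002_thm21` (provefact unit): the rescaling (19)
of a solution of energy `E`,
`p̃(s) = E^{-1/2} p(E^{1/k-1/2} s)`, `q̃(s) = E^{-1/k} q(E^{1/k-1/2} s)`, `r̃(s) = E^{-1/k} r(E^{1/k-1/2} s)`,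
and the rescaled equations of motion (20),
`q̃' = p̃`, `p̃' = -∇Ṽ_E(q̃) - E^{2/k-1} Λᵀ r̃`, `r̃' = -E^{1/k-1/2} γ r̃ + Λ p̃` (+ rescaled noise),
with `Ṽ_E` built from the rescaled potentials `Ũ_E(y) = E⁻¹ U(E^{1/k} y)` of
`ReyBelletThomas2002Growth.lean` (here for ONE exponent `k = k₁ = k₂`, the regime in which the
printed scaling argument applies), as EXACT identities for the integral equations:

* `OscillatorChain.rbDriftGen P Λ N c_p c_r` — the drift of (20)/(21)/(22) with reservoir
  coefficients `c_p` (on `Λᵀ r` in `ṗ`) and `c_r` (on `γ r` in `ṙ`); `rbDriftGen P Λ N 1 1 = rbDrift`;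
* `OscillatorChain.rbScaled P k E` — the chain data `(Ũ_E, Ṽ_E, γ)`; `rbScaleCLM N k E` — the
  linear rescaling `(q, p, r) ↦ (E^{-1/k} q, E^{-1/2} p, E^{-1/k} r)`; `timeScale k E = E^{1/k-1/2}`;
* `dPotential_rbScaled` — `∇Ṽ_E(E^{-1/k} q) = E^{1/k-1} ∇V(q)`;
* `timeScale_smul_rbScale_rbDrift` — the algebra `t_E · L_E(Y(z)) = Ỹ_E(L_E z)` with
  `Ỹ_E = rbDriftGen (rbScaled P k E) Λ N E^{2/k-1} E^{1/k-1/2}`;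
* `isIntegralSolutionOn_rbScale` — **conjugacy**: if `x` solves `x = x₀ + n + ∫ Y(x)` on `[0, T]`
  then `s ↦ L_E x(t_E s)` solves `x̃ = L_E x₀ + L_E n(t_E ·) + ∫ Ỹ_E(x̃)` on `[0, T/t_E]`;
* `rbEnergy_eq_mul_rbScaledEnergy` — `G = E · G̃_E ∘ L_E` with
  `G̃_E = E^{2/k-1} r̃²/2 + p̃²/2 + Ṽ_E(q̃)` (the display after (19));
* `integral_sq_eq_rpow_mul` — `∫₀^{t_E τ} (r_L² + r_R²) dt = E^{3/k-1/2} ∫₀^τ (r̃_L² + r̃_R²) ds` (eq. (24)).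

## References

* L. Rey-Bellet, L. E. Thomas, Comm. Math. Phys. **225** (2002) 305–329, §3.1 eqs. (18)–(24).
-/

noncomputable section

open MeasureTheory Filter Topology Set intervalIntegral
open scoped NNReal

namespace Literature.MathematicalPhysics.KineticTheory.HeatConduction

open Literature.Analysis.ODE Literature.MathematicalPhysics.KineticTheory

variable {N : ℕ}

namespace OscillatorChain

variable (P : OscillatorChain)

/-! ### The rescaled drift, the rescaled chain data and the rescaling map -/

/-- The **drift of the rescaled equations (20)** with reservoir coefficients `c_p, c_r`:
`q̇ = p`, `ṗ = -∇Φ(q) - c_p Λᵀ r`, `ṙ = -c_r γ r + Λ p` (`c_p = E^{2/k-1}`, `c_r = E^{1/k-1/2}`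
for (20); `c_p = c_r = 0` for the limit (21), `c_p = c_r = 1` for (18)/(22)).
[cite: ReyBelletThomas2002, §3.1 eq. (20)] -/
def rbDriftGen (Λ : ℝ) (N : ℕ) (c_p c_r : ℝ) (x : RBPhaseSpace N) : RBPhaseSpace N :=
  ((x.1.2, fun i => -P.dPotential N i x.1.1 -
      c_p * Λ * ((if i.val = 0 then x.2.1 else 0) + (if i.val = N - 1 then x.2.2 else 0))),
    (-(c_r * P.γ * x.2.1) + Λ * ∑ i : Fin N, (if i.val = 0 then x.1.2 i else 0),
      -(c_r * P.γ * x.2.2) + Λ * ∑ i : Fin N, (if i.val = N - 1 then x.1.2 i else 0)))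

variable {P} in
/-- With unit coefficients the rescaled drift is the drift of (RBT-SDE) (differentiable
potentials). [cite: ReyBelletThomas2002, §3.1 eq. (18)] -/
theorem rbDriftGen_one_one (hU : Differentiable ℝ P.U) (hV : Differentiable ℝ P.V) (Λ : ℝ)
    (N : ℕ) : P.rbDriftGen Λ N 1 1 = P.rbDrift Λ N := by
  rw [P.rbDrift_eq hU hV]
  funext x
  simp only [rbDriftGen, one_mul]

/-- The **rescaled chain data** `(Ũ_E, Ṽ_E, γ)` of (19) (one exponent `k`).
[cite: ReyBelletThomas2002, §3.1 eq. (19)] -/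
def rbScaled (k E : ℝ) : OscillatorChain :=
  ⟨RBGrowth.scaledPot P.U k E, RBGrowth.scaledPot P.V k E, P.γ⟩

/-- The potentials of the rescaled chain data. [folklore] -/
@[simp] theorem rbScaled_U (k E : ℝ) : (P.rbScaled k E).U = RBGrowth.scaledPot P.U k E := rfl

/-- The potentials of the rescaled chain data. [folklore] -/
@[simp] theorem rbScaled_V (k E : ℝ) : (P.rbScaled k E).V = RBGrowth.scaledPot P.V k E := rfl

/-- The friction of the rescaled chain data is unchanged. [folklore] -/
@[simp] theorem rbScaled_γ (k E : ℝ) : (P.rbScaled k E).γ = P.γ := rfl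

end OscillatorChain

/-- The **linear rescaling** `L_E (q, p, r) = (E^{-1/k} q, E^{-1/2} p, E^{-1/k} r)` of (19), as a
continuous linear map. [cite: ReyBelletThomas2002, §3.1 eq. (19)] -/
def rbScaleCLM (N : ℕ) (k E : ℝ) : RBPhaseSpace N →L[ℝ] RBPhaseSpace N :=
  (((E ^ (-(1 / k))) • (ContinuousLinearMap.fst ℝ (Fin N → ℝ) (Fin N → ℝ)).comp
      (ContinuousLinearMap.fst ℝ (PhaseSpace N) (ℝ × ℝ))).prod
    ((E ^ (-(1 / 2 : ℝ))) • (ContinuousLinearMap.snd ℝ (Fin N → ℝ) (Fin N → ℝ)).comp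
      (ContinuousLinearMap.fst ℝ (PhaseSpace N) (ℝ × ℝ)))).prod
    ((E ^ (-(1 / k))) • ContinuousLinearMap.snd ℝ (PhaseSpace N) (ℝ × ℝ))

/-- The rescaling map in coordinates. [cite: ReyBelletThomas2002, §3.1 eq. (19)] -/
@[simp] theorem rbScaleCLM_apply (N : ℕ) (k E : ℝ) (x : RBPhaseSpace N) :
    rbScaleCLM N k E x = ((E ^ (-(1 / k)) • x.1.1, E ^ (-(1 / 2 : ℝ)) • x.1.2), E ^ (-(1 / k)) • x.2) :=
  rfl

/-- The **natural time scale** `t_E = E^{1/k - 1/2}` of a single oscillator of energy `E` in the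
potential `|q|^k`. [cite: ReyBelletThomas2002, §3.1 (before eq. (19))] -/
def timeScale (k E : ℝ) : ℝ :=
  E ^ (1 / k - 1 / 2)

/-- `t_E > 0`. [folklore] -/
theorem timeScale_pos (k : ℝ) {E : ℝ} (hE : 0 < E) : 0 < timeScale k E :=
  Real.rpow_pos_of_pos hE _

/-! ### The scaling algebra -/

section Algebra

/-- `Ũ_E'(E^{-1/k} y) = E^{1/k-1} U'(y)`. [cite: ReyBelletThomas2002, §3.1 eq. (20)] -/
theorem deriv_scaledPot_rpow_neg_mul {W : ℝ → ℝ} {k : ℝ} (hW : RBGrowth W k) {E : ℝ} (hE : 0 < E)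
    (y : ℝ) :
    deriv (RBGrowth.scaledPot W k E) (E ^ (-(1 / k)) * y) = E ^ (1 / k - 1) * deriv W y := by
  rw [hW.deriv_scaledPot hE, ← mul_assoc, ← Real.rpow_add hE, add_neg_cancel, Real.rpow_zero,
    one_mul]

/-- `t_E E^{-1/k} = E^{-1/2}`. [folklore] -/
theorem timeScale_mul_rpow_neg_inv (k : ℝ) {E : ℝ} (hE : 0 < E) :
    timeScale k E * E ^ (-(1 / k)) = E ^ (-(1 / 2 : ℝ)) := by
  rw [timeScale, ← Real.rpow_add hE]; congr 1; ring

/-- `t_E E^{-1/2} = E^{1/k - 1}`. [folklore] -/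
theorem timeScale_mul_rpow_neg_half (k : ℝ) {E : ℝ} (hE : 0 < E) :
    timeScale k E * E ^ (-(1 / 2 : ℝ)) = E ^ (1 / k - 1) := by
  rw [timeScale, ← Real.rpow_add hE]; congr 1; ring

/-- `E^{2/k-1} E^{-1/k} = E^{1/k-1}`. [folklore] -/
theorem rpow_two_div_sub_one_mul (k : ℝ) {E : ℝ} (hE : 0 < E) :
    E ^ (2 / k - 1) * E ^ (-(1 / k)) = E ^ (1 / k - 1) := by
  rw [← Real.rpow_add hE]; congr 1; ring

/-- `E^{1/k-1/2} E^{-1/k} = E^{-1/2}` (for the friction term). [folklore] -/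
theorem rpow_inv_sub_half_mul (k : ℝ) {E : ℝ} (hE : 0 < E) :
    E ^ (1 / k - 1 / 2) * E ^ (-(1 / k)) = E ^ (-(1 / 2 : ℝ)) := by
  rw [← Real.rpow_add hE]; congr 1; ring

variable {P : OscillatorChain} {k : ℝ} (hU : RBGrowth P.U k) (hV : RBGrowth P.V k) {E : ℝ} (hE : 0 < E)
include hU hV hE

/-- **The rescaled force**: `∇Ṽ_E(E^{-1/k} q) = E^{1/k-1} ∇V(q)`. [cite: ReyBelletThomas2002, §3.1 eq. (20)] -/
theorem dPotential_rbScaled (N : ℕ) (i : Fin N) (q : Fin N → ℝ) :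
    (P.rbScaled k E).dPotential N i (E ^ (-(1 / k)) • q) = E ^ (1 / k - 1) * P.dPotential N i q := by
  rw [OscillatorChain.dPotential_eq_closed, OscillatorChain.dPotential_eq_closed]
  simp only [OscillatorChain.rbScaled_U, OscillatorChain.rbScaled_V, Pi.smul_apply, smul_eq_mul]
  have hsub : ∀ a b : ℝ, E ^ (-(1 / k)) * a - E ^ (-(1 / k)) * b = E ^ (-(1 / k)) * (a - b) :=
    fun a b => by ring
  simp only [hsub, deriv_scaledPot_rpow_neg_mul hU hE, deriv_scaledPot_rpow_neg_mul hV hE]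
  split_ifs <;> ring

/-- **The scaling algebra of the drift**: `t_E · L_E(Y(z)) = Ỹ_E(L_E z)` with
`Ỹ_E = rbDriftGen (rbScaled P k E) Λ N E^{2/k-1} E^{1/k-1/2}` — the passage from (18) to (20).
[cite: ReyBelletThomas2002, §3.1 eq. (20)] -/
theorem timeScale_smul_rbScale_rbDrift (Λ : ℝ) (N : ℕ) (z : RBPhaseSpace N) :
    timeScale k E • rbScaleCLM N k E (P.rbDrift Λ N z) =
      (P.rbScaled k E).rbDriftGen Λ N (E ^ (2 / k - 1)) (E ^ (1 / k - 1 / 2)) (rbScaleCLM N k E z) := by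
  rw [P.rbDrift_eq hU.differentiable hV.differentiable]
  have hq := timeScale_mul_rpow_neg_inv k hE
  have hp := timeScale_mul_rpow_neg_half k hE
  have h2 := rpow_two_div_sub_one_mul k hE
  have h3 := rpow_inv_sub_half_mul k hE
  refine Prod.ext (Prod.ext ?_ ?_) (Prod.ext ?_ ?_)
  · -- positions: `t_E E^{-1/k} p = E^{-1/2} p`
    funext i
    simp only [rbScaleCLM_apply, OscillatorChain.rbDriftGen, Prod.smul_fst, Pi.smul_apply,
      smul_eq_mul, ← mul_assoc, hq]
  · -- momenta
    funext i
    simp only [rbScaleCLM_apply, OscillatorChain.rbDriftGen, Prod.smul_fst, Prod.smul_snd,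
      Pi.smul_apply, smul_eq_mul, dPotential_rbScaled hU hV hE]
    have e1 : timeScale k E * (E ^ (-(1 / 2 : ℝ)) * (-P.dPotential N i z.1.1 -
        Λ * ((if i.val = 0 then z.2.1 else 0) + (if i.val = N - 1 then z.2.2 else 0)))) =
        -(timeScale k E * E ^ (-(1 / 2 : ℝ))) * P.dPotential N i z.1.1 -
          (timeScale k E * E ^ (-(1 / 2 : ℝ))) * Λ *
            ((if i.val = 0 then z.2.1 else 0) + (if i.val = N - 1 then z.2.2 else 0)) := by ring
    rw [e1, hp]
    have e2 : ∀ c : ℝ, (if i.val = 0 then E ^ (-(1 / k)) * c else 0) =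
        E ^ (-(1 / k)) * (if i.val = 0 then c else 0) := fun c => by split_ifs <;> ring
    have e3 : ∀ c : ℝ, (if i.val = N - 1 then E ^ (-(1 / k)) * c else 0) =
        E ^ (-(1 / k)) * (if i.val = N - 1 then c else 0) := fun c => by split_ifs <;> ring
    simp only [e2, e3]
    rw [← h2]
    ring
  · -- `r_L`
    simp only [rbScaleCLM_apply, OscillatorChain.rbDriftGen, Prod.smul_snd, Prod.smul_fst,
      Pi.smul_apply, smul_eq_mul, Prod.smul_mk, OscillatorChain.rbScaled_γ]
    have e2 : ∀ j : Fin N, (if j.val = 0 then E ^ (-(1 / 2 : ℝ)) * z.1.2 j else 0) =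
        E ^ (-(1 / 2 : ℝ)) * (if j.val = 0 then z.1.2 j else 0) := fun j => by split_ifs <;> ring
    simp only [e2, ← Finset.mul_sum]
    rw [← h3]
    unfold timeScale
    ring
  · -- `r_R`
    simp only [rbScaleCLM_apply, OscillatorChain.rbDriftGen, Prod.smul_snd, Prod.smul_fst,
      Pi.smul_apply, smul_eq_mul, Prod.smul_mk, OscillatorChain.rbScaled_γ]
    have e2 : ∀ j : Fin N, (if j.val = N - 1 then E ^ (-(1 / 2 : ℝ)) * z.1.2 j else 0) =
        E ^ (-(1 / 2 : ℝ)) * (if j.val = N - 1 then z.1.2 j else 0) := fun j => by split_ifs <;> ring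
    simp only [e2, ← Finset.mul_sum]
    rw [← h3]
    unfold timeScale
    ring

end Algebra

/-! ### Conjugacy of the integral equations -/

section Conjugacy

variable {P : OscillatorChain} {k : ℝ} (hU : RBGrowth P.U k) (hV : RBGrowth P.V k) {E : ℝ} (hE : 0 < E)
  (Λ : ℝ) (N : ℕ)
include hU hV hE

/-- **Conjugacy of the integral equations under the rescaling (19)**: if `x` is a continuous
solution of `x(t) = x₀ + n(t) + ∫₀ᵗ Y(x)` on `[0, T]` (`Y = rbDrift`), then
`x̃(s) = L_E x(t_E s)` solves `x̃(s) = L_E x₀ + L_E n(t_E s) + ∫₀ˢ Ỹ_E(x̃)` on `[0, T/t_E]` —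
the rescaled equations of motion (20) in integral form, with the rescaled noise.
[cite: ReyBelletThomas2002, §3.1 eqs. (19)–(20)] -/
theorem isIntegralSolutionOn_rbScale {x n : ℝ → RBPhaseSpace N} {x₀ : RBPhaseSpace N} {T : ℝ}
    (hx : IsIntegralSolutionOn (P.rbDrift Λ N) (fun t => x₀ + n t) x T) (hxc : Continuous x) :
    IsIntegralSolutionOn ((P.rbScaled k E).rbDriftGen Λ N (E ^ (2 / k - 1)) (E ^ (1 / k - 1 / 2)))
      (fun s => rbScaleCLM N k E x₀ + rbScaleCLM N k E (n (timeScale k E * s)))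
      (fun s => rbScaleCLM N k E (x (timeScale k E * s))) (T / timeScale k E) := by
  set L := rbScaleCLM N k E with hL
  set tE := timeScale k E with htE
  have htE0 : 0 < tE := timeScale_pos k hE
  have hYc : Continuous (P.rbDrift Λ N) := (P.contDiff_rbDrift hU.1 hV.1 Λ N).continuous
  intro s hs
  have ht : tE * s ∈ Icc 0 T := by
    refine ⟨mul_nonneg htE0.le hs.1, ?_⟩
    have := mul_le_mul_of_nonneg_left hs.2 htE0.le
    rwa [mul_div_cancel₀ _ htE0.ne'] at this
  have hxt := hx (tE * s) ht
  -- rescale the integral equation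
  have hint : IntervalIntegrable (fun τ => P.rbDrift Λ N (x τ)) volume 0 (tE * s) :=
    (hYc.comp hxc).intervalIntegrable _ _
  have hLint : L (∫ τ in (0 : ℝ)..(tE * s), P.rbDrift Λ N (x τ)) =
      ∫ τ in (0 : ℝ)..(tE * s), L (P.rbDrift Λ N (x τ)) := (L.intervalIntegral_comp_comm hint).symm
  have hsub : ∫ τ in (0 : ℝ)..(tE * s), L (P.rbDrift Λ N (x τ)) =
      tE • ∫ u in (0 : ℝ)..s, L (P.rbDrift Λ N (x (tE * u))) := by
    have := intervalIntegral.smul_integral_comp_mul_left (f := fun τ => L (P.rbDrift Λ N (x τ)))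
      (a := 0) (b := s) tE
    rw [mul_zero] at this
    exact this.symm
  have halg : ∀ u, tE • L (P.rbDrift Λ N (x (tE * u))) =
      (P.rbScaled k E).rbDriftGen Λ N (E ^ (2 / k - 1)) (E ^ (1 / k - 1 / 2)) (L (x (tE * u))) :=
    fun u => timeScale_smul_rbScale_rbDrift hU hV hE Λ N (x (tE * u))
  calc L (x (tE * s)) = L x₀ + L (n (tE * s)) + L (∫ τ in (0 : ℝ)..(tE * s), P.rbDrift Λ N (x τ)) := by
        rw [hxt, map_add, map_add]
    _ = L x₀ + L (n (tE * s)) + ∫ u in (0 : ℝ)..s,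
          (P.rbScaled k E).rbDriftGen Λ N (E ^ (2 / k - 1)) (E ^ (1 / k - 1 / 2)) (L (x (tE * u))) := by
        rw [hLint, hsub, ← intervalIntegral.integral_smul]
        simp_rw [halg]

end Conjugacy

/-! ### The rescaled energy and the dissipation -/

namespace OscillatorChain

variable (P : OscillatorChain)

/-- The **rescaled energy** `G̃_E(p̃, q̃, r̃) = E^{2/k-1} r̃²/2 + p̃²/2 + Ṽ_E(q̃)` (the display after
(19); `Ṽ_E` includes the rescaled pinning and interaction). [cite: ReyBelletThomas2002, §3.1 (after eq. (19))] -/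
def rbScaledEnergy (k E : ℝ) (N : ℕ) (x : RBPhaseSpace N) : ℝ :=
  E ^ (2 / k - 1) * ((x.2.1 ^ 2 + x.2.2 ^ 2) / 2) + (P.rbScaled k E).hamiltonian N x.1

variable {P}

/-- The rescaled Hamiltonian at a rescaled point: `E · H̃_E(L_E z) = H(z)` (`E > 0`, `k ≠ 0`).
[cite: ReyBelletThomas2002, §3.1 (after eq. (19))] -/
theorem mul_hamiltonian_rbScaled {k E : ℝ} (hE : 0 < E) (N : ℕ) (z : PhaseSpace N) :
    E * (P.rbScaled k E).hamiltonian N (E ^ (-(1 / k)) • z.1, E ^ (-(1 / 2 : ℝ)) • z.2) =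
      P.hamiltonian N z := by
  unfold OscillatorChain.hamiltonian
  simp only [rbScaled_U, rbScaled_V, Pi.smul_apply, smul_eq_mul, RBGrowth.scaledPot]
  have hin : ∀ y : ℝ, E ^ (1 / k) * (E ^ (-(1 / k)) * y) = y := fun y => by
    rw [← mul_assoc, ← Real.rpow_add hE, add_neg_cancel, Real.rpow_zero, one_mul]
  have hsub : ∀ a b : ℝ, E ^ (-(1 / k)) * a - E ^ (-(1 / k)) * b = E ^ (-(1 / k)) * (a - b) :=
    fun a b => by ring
  have hp : ∀ y : ℝ, E * ((E ^ (-(1 / 2 : ℝ)) * y) ^ 2 / 2) = y ^ 2 / 2 := fun y => by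
    have : (E ^ (-(1 / 2 : ℝ))) ^ 2 = E⁻¹ := by
      rw [← Real.rpow_natCast, ← Real.rpow_mul hE.le]; norm_num; exact Real.rpow_neg_one E
    rw [mul_pow, this]; field_simp
  simp only [hsub, hin]
  rw [mul_add, Finset.mul_sum, Finset.mul_sum]
  congr 1
  · refine Finset.sum_congr rfl fun i _ => ?_
    rw [mul_add, hp]
    field_simp
  · refine Finset.sum_congr rfl fun i _ => ?_
    rw [Finset.mul_sum]
    refine Finset.sum_congr rfl fun j _ => ?_
    split_ifs
    · field_simp
    · simp

/-- **Energy scaling** (the display after (19)): `G(z) = E · G̃_E(L_E z)` (`E > 0`, `k ≠ 0`).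
[cite: ReyBelletThomas2002, §3.1 (after eq. (19))] -/
theorem rbEnergy_eq_mul_rbScaledEnergy {k E : ℝ} (hE : 0 < E) (N : ℕ) (z : RBPhaseSpace N) :
    P.rbEnergy N z = E * P.rbScaledEnergy k E N (rbScaleCLM N k E z) := by
  unfold rbScaledEnergy rbEnergy
  simp only [rbScaleCLM_apply, Prod.smul_fst, Prod.smul_snd, smul_eq_mul]
  rw [mul_add, mul_hamiltonian_rbScaled hE N z.1]
  congr 1
  have h2 : E * E ^ (2 / k - 1) * (E ^ (-(1 / k))) ^ 2 = 1 := by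
    rw [sq, show E * E ^ (2 / k - 1) * (E ^ (-(1 / k)) * E ^ (-(1 / k))) =
      E ^ (1 : ℝ) * E ^ (2 / k - 1) * E ^ (-(1 / k)) * E ^ (-(1 / k)) by rw [Real.rpow_one]; ring,
      ← Real.rpow_add hE, ← Real.rpow_add hE, ← Real.rpow_add hE]
    rw [show (1 : ℝ) + (2 / k - 1) + -(1 / k) + -(1 / k) = 0 by ring, Real.rpow_zero]
  have : E * (E ^ (2 / k - 1) * (((E ^ (-(1 / k)) * z.2.1) ^ 2 + (E ^ (-(1 / k)) * z.2.2) ^ 2) / 2)) =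
      (E * E ^ (2 / k - 1) * (E ^ (-(1 / k))) ^ 2) * ((z.2.1 ^ 2 + z.2.2 ^ 2) / 2) := by ring
  rw [this, h2, one_mul]

/-- **Dissipation scaling** (eq. (24)): for any path `x` and its rescaling `x̃(s) = L_E x(t_E s)`,
`∫₀^{t_E τ} (r_L² + r_R²) dt = E^{3/k-1/2} ∫₀^τ (r̃_L² + r̃_R²) ds` (`E > 0`).
[cite: ReyBelletThomas2002, §3.1 eq. (24)] -/
theorem integral_sq_eq_rpow_mul {k E : ℝ} (hE : 0 < E) (N : ℕ) (x : ℝ → RBPhaseSpace N) (τ : ℝ) :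
    ∫ t in (0 : ℝ)..(timeScale k E * τ), ((x t).2.1 ^ 2 + (x t).2.2 ^ 2) =
      E ^ (3 / k - 1 / 2) * ∫ s in (0 : ℝ)..τ,
        ((rbScaleCLM N k E (x (timeScale k E * s))).2.1 ^ 2 +
          (rbScaleCLM N k E (x (timeScale k E * s))).2.2 ^ 2) := by
  set tE := timeScale k E with htE
  have hsub := intervalIntegral.smul_integral_comp_mul_left
    (f := fun t => (x t).2.1 ^ 2 + (x t).2.2 ^ 2) (a := 0) (b := τ) tE
  rw [mul_zero] at hsub
  rw [← hsub, smul_eq_mul]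
  simp only [rbScaleCLM_apply, Prod.smul_snd, Prod.smul_fst, smul_eq_mul]
  have hc : ∀ a b : ℝ, (E ^ (-(1 / k)) * a) ^ 2 + (E ^ (-(1 / k)) * b) ^ 2 =
      (E ^ (-(1 / k))) ^ 2 * (a ^ 2 + b ^ 2) := fun a b => by ring
  simp only [hc, intervalIntegral.integral_const_mul]
  rw [← mul_assoc]
  congr 1
  rw [htE, timeScale, sq, ← Real.rpow_add hE, ← Real.rpow_add hE]
  congr 1
  ring

end OscillatorChain

end Literature.MathematicalPhysics.KineticTheory.HeatConduction

end
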